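import Literature.Barriers.CriticalPhenomena.GridSAWScaledDrawing
import Literature.Barriers.CriticalPhenomena.GridSAWAnyLengthDrawingCount
import HarnessLib

/-!
# Barrier `GridSAWCountingSharpPComplete`, squares step: the CONCRETE squares of `E₃` on a
# scaled drawing, their admissibility, and the count `Σ_π 2^{β · #edges(π)}`

Sibling of `GridSAWSquareSites.lean` (square sites `σ` on a drawing, `IsSiteList`, and the
counting identity `IsSiteList.ncard_saw_withSquares`: the SAWs of `withSquares D σ` between
non-corner points number `Σ_{π ∈ sawFinset (drawnEdges D) a b} 2 ^ #(sitesAlong σ π)`),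
`GridSAWScaledDrawing.lean` (`scaleDrawing k D`, `IsGridDrawing.scale`: enlarging a congestion-free
grid drawing by `k` gives one; `runPt`/`scalePath` of `GridSAWTowers.lean`) and
`GridSAWAnyLengthDrawingCount.lean` (walks of any length between vertex images ↔ abstract simple
paths, `sum_sawFinset_drawnEdges_eq`; which edges a realisation uses, `countP_usedBy`), towards the
named sub-fact `LOT2003_thm7_anyLength_squares : GRIDHAMPATHCOUNT ≤ᵖ_{r-shift} SAWCOUNT₄`
(`GridSAWCountingAnyLengthViaGridHamPath.lean`; Liśkiewicz–Ogihara–Toda 2003, Theorem 7 (4)).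
The printed `E₃`: "We enlarge `E₂` by a factor of `α` … Then for each edge `e` of `G′` identify a
horizontal line of length `α` and attach above the line `β` unit-size squares with a gap of unit
length in between (see Fig. 8). This is `E₃`. Note that, for each edge `e` of `G′`, now `e` is
realized by a set of `2^β` paths" [LOT2003, §4, proof of Theorem 7, PDF p. 11]. This file places
the squares and counts, for an ARBITRARY congestion-free grid drawing `(P, D)` scaled by
`k ≥ 2β + 3` (the towers of `E₂` equalise lengths and are not needed when walks of any length
are counted; the line of each edge is the scaled FIRST unit step of its path, horizontal or
vertical — squares go above a horizontal line and to the right of a vertical one):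

* `quad k z` (quotients and remainders of the coordinates modulo `k`), `sideVec u`,
  `cornerOf k p u c = runPt k p u c + sideVec u` and its arithmetic: both remainders of a
  corner are non-zero (`rem_ne_zero_cornerOf`) while every point of a scaled path has a zero
  remainder (`rem_zero_of_mem_scalePath`), and equal corners have equal feet
  (`runPt_eq_of_cornerOf_eq`);
* `firstStep`, `sqSite k e j` (feet `runPt k p u (2j+2)`, `runPt k p u (2j+3)` on the scaled
  first step of `e`, corners beside them), `sqSites k β D` (`β` squares on every drawn edge) and
  **`isSiteList_sqSites`**: for `2β + 3 ≤ k` they form an admissible family of square sites on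
  the scaled drawing (`IsSiteList`), with unit-square geometry (`sqSites_geometry`, so
  `withSquares` is a subgraph of the grid);
* **`card_sitesAlong_sqSites_realize`**: the realisation of an abstract simple path with
  `m + 1` vertices runs along exactly `β m` of the squares ("`e` is realized by a set of `2^β`
  paths" edge by edge);
* **`ncard_saw_squares`**: for `s ≠ t`, the SAWs of the decorated scaled drawing from the
  image of `s` to the image of `t` number `Σ_π 2 ^ (β · #edges(π))` over the abstract simple
  `s`–`t` paths `π` — the printed "`Y · 2^{β(N+1)}` plus the contribution of the `η`
  non-Hamiltonian simple paths", before the right shift; `not_isCorner_smul` (vertex images are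
  not corners).

Everything is proved; the reduction on strings is the sequel.

## References

* M. Liśkiewicz, M. Ogihara, S. Toda, *The complexity of counting self-avoiding walks in
  subgraphs of two-dimensional grids and hypercubes*, TCS 304 (2003) 129–156, §4, proof of
  Theorem 7 (`E₃`, Fig. 8; fourth type).
-/

noncomputable section

namespace Literature.Barriers.CriticalPhenomena.GridSAW

open Finset

/-! ### Quotients and remainders modulo the factor -/

/-- The signature `(z.1 div k, z.1 mod k, z.2 div k, z.2 mod k)` of a point. [folklore] -/
def quad (k : ℕ) (z : GridPoint) : ℤ × ℤ × ℤ × ℤ := (z.1 / k, z.1 % k, z.2 / k, z.2 % k)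

/-- A point is determined by its signature. [folklore] -/
theorem eq_of_quad_eq {k : ℕ} {z z' : GridPoint} (h : quad k z = quad k z') : z = z' := by
  simp only [quad, Prod.mk.injEq] at h
  obtain ⟨h1, h2, h3, h4⟩ := h
  refine Prod.ext ?_ ?_
  · rw [← Int.emod_add_mul_ediv z.1 k, ← Int.emod_add_mul_ediv z'.1 k, h1, h2]
  · rw [← Int.emod_add_mul_ediv z.2 k, ← Int.emod_add_mul_ediv z'.2 k, h3, h4]

/-- Both remainders of a scaled lattice point vanish. [folklore] -/
theorem rem_zero_smul (k : ℕ) (v : GridPoint) :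
    ((k : ℤ) • v).1 % (k : ℤ) = 0 ∧ ((k : ℤ) • v).2 % (k : ℤ) = 0 := by
  simp [Int.mul_emod_right]

/-- **Every point of a scaled chain of grid edges has a vanishing remainder** (run points have
a coordinate divisible by `k`, `runPt_coord_mul`; so has the scaled last point). [folklore] -/
theorem rem_zero_of_mem_scalePath {k : ℕ} {p : GridPoint} {l : List GridPoint}
    (hch : List.IsChain IsGridEdge (p :: l)) {X : GridPoint} (hX : X ∈ scalePath k (p :: l)) :
    X.1 % (k : ℤ) = 0 ∨ X.2 % (k : ℤ) = 0 := by
  rcases (mem_scalePath p l).mp hX with ⟨i, hi, s, -, rfl⟩ | rfl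
  · rcases runPt_coord_mul k (isUnitVec_step hch hi) ((p :: l)[i]'(by omega)) s with h | h
    · exact Or.inr (by rw [h]; simp [Int.mul_emod_right])
    · exact Or.inl (by rw [h]; simp [Int.mul_emod_right])
  · exact Or.inl (rem_zero_smul k _).1

/-! ### Corners of the squares -/

/-- The side on which squares are attached along a run of direction `u`: above a horizontal
run ("attach above the line"), to the right of a vertical one.
[cite: LiskiewiczOgiharaToda2003, §4 (proof of Theorem 7, E₃, Fig. 8)] -/
def sideVec (u : GridPoint) : GridPoint := if u.2 = 0 then (0, 1) else (1, 0)

/-- The outer corner of the square beside the `c`-th run point. [cite: LiskiewiczOgiharaToda2003, §4 (proof of Theorem 7, E₃, Fig. 8)] -/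
def cornerOf (k : ℕ) (p u : GridPoint) (c : ℕ) : GridPoint := runPt k p u c + sideVec u

/-- The side vector is a unit vector: a run point and its corner are grid neighbours. [folklore] -/
theorem isGridEdge_add_sideVec (z u : GridPoint) : IsGridEdge z (z + sideVec u) := by
  unfold IsGridEdge sideVec
  split_ifs <;> simp

/-- Corner beside a rightward run. [folklore] -/
theorem quad_cornerOf_right {k c : ℕ} (hc : c < k) (h1 : 1 < k) (p : GridPoint) :
    quad k (cornerOf k p (1, 0) c) = (p.1, (c : ℤ), p.2, 1) := by
  have hk' : (0 : ℤ) < k := by exact_mod_cast (Nat.zero_lt_of_lt hc)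
  have e1 : (cornerOf k p (1, 0) c).1 = c + k * p.1 := by
    simp [cornerOf, sideVec, runPt_fst]; ring
  have e2 : (cornerOf k p (1, 0) c).2 = 1 + k * p.2 := by
    simp [cornerOf, sideVec, runPt_snd]; ring
  obtain ⟨q1, r1⟩ := (Int.ediv_emod_unique hk').mpr ⟨e1.symm, by omega, by omega⟩
  obtain ⟨q2, r2⟩ := (Int.ediv_emod_unique hk').mpr ⟨e2.symm, by omega, by omega⟩
  simp only [quad, Prod.mk.injEq]
  exact ⟨q1, r1, q2, r2⟩

/-- Corner beside a leftward run. [folklore] -/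
theorem quad_cornerOf_left {k c : ℕ} (h0 : 0 < c) (hc : c < k) (h1 : 1 < k) (p : GridPoint) :
    quad k (cornerOf k p (-1, 0) c) = (p.1 - 1, (k : ℤ) - c, p.2, 1) := by
  have hk' : (0 : ℤ) < k := by exact_mod_cast (Nat.zero_lt_of_lt hc)
  have e1 : (cornerOf k p (-1, 0) c).1 = (k - c) + k * (p.1 - 1) := by
    simp [cornerOf, sideVec, runPt_fst]; ring
  have e2 : (cornerOf k p (-1, 0) c).2 = 1 + k * p.2 := by
    simp [cornerOf, sideVec, runPt_snd]; ring
  obtain ⟨q1, r1⟩ := (Int.ediv_emod_unique hk').mpr ⟨e1.symm, by omega, by omega⟩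
  obtain ⟨q2, r2⟩ := (Int.ediv_emod_unique hk').mpr ⟨e2.symm, by omega, by omega⟩
  simp only [quad, Prod.mk.injEq]
  exact ⟨q1, r1, q2, r2⟩

/-- Corner beside an upward run. [folklore] -/
theorem quad_cornerOf_up {k c : ℕ} (hc : c < k) (h1 : 1 < k) (p : GridPoint) :
    quad k (cornerOf k p (0, 1) c) = (p.1, 1, p.2, (c : ℤ)) := by
  have hk' : (0 : ℤ) < k := by exact_mod_cast (Nat.zero_lt_of_lt hc)
  have e1 : (cornerOf k p (0, 1) c).1 = 1 + k * p.1 := by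
    simp [cornerOf, sideVec, runPt_fst]; ring
  have e2 : (cornerOf k p (0, 1) c).2 = c + k * p.2 := by
    simp [cornerOf, sideVec, runPt_snd]; ring
  obtain ⟨q1, r1⟩ := (Int.ediv_emod_unique hk').mpr ⟨e1.symm, by omega, by omega⟩
  obtain ⟨q2, r2⟩ := (Int.ediv_emod_unique hk').mpr ⟨e2.symm, by omega, by omega⟩
  simp only [quad, Prod.mk.injEq]
  exact ⟨q1, r1, q2, r2⟩

/-- Corner beside a downward run. [folklore] -/
theorem quad_cornerOf_down {k c : ℕ} (h0 : 0 < c) (hc : c < k) (h1 : 1 < k) (p : GridPoint) :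
    quad k (cornerOf k p (0, -1) c) = (p.1, 1, p.2 - 1, (k : ℤ) - c) := by
  have hk' : (0 : ℤ) < k := by exact_mod_cast (Nat.zero_lt_of_lt hc)
  have e1 : (cornerOf k p (0, -1) c).1 = 1 + k * p.1 := by
    simp [cornerOf, sideVec, runPt_fst]; ring
  have e2 : (cornerOf k p (0, -1) c).2 = (k - c) + k * (p.2 - 1) := by
    simp [cornerOf, sideVec, runPt_snd]; ring
  obtain ⟨q1, r1⟩ := (Int.ediv_emod_unique hk').mpr ⟨e1.symm, by omega, by omega⟩
  obtain ⟨q2, r2⟩ := (Int.ediv_emod_unique hk').mpr ⟨e2.symm, by omega, by omega⟩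
  simp only [quad, Prod.mk.injEq]
  exact ⟨q1, r1, q2, r2⟩

/-- **Signature of a corner**, by direction of the run: both remainders are non-zero, and the
first remainder is `1` exactly for vertical runs. [folklore] -/
theorem quad_cornerOf {k c : ℕ} {u : GridPoint} (hu : IsUnitVec u) (h0 : 0 < c) (hc : c < k)
    (h1 : 1 < k) (p : GridPoint) :
    (u = (1, 0) ∧ quad k (cornerOf k p u c) = (p.1, (c : ℤ), p.2, 1)) ∨
    (u = (-1, 0) ∧ quad k (cornerOf k p u c) = (p.1 - 1, (k : ℤ) - c, p.2, 1)) ∨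
    (u = (0, 1) ∧ quad k (cornerOf k p u c) = (p.1, 1, p.2, (c : ℤ))) ∨
    (u = (0, -1) ∧ quad k (cornerOf k p u c) = (p.1, 1, p.2 - 1, (k : ℤ) - c)) := by
  rcases hu with rfl | rfl | rfl | rfl
  · exact Or.inl ⟨rfl, quad_cornerOf_right hc h1 p⟩
  · exact Or.inr (Or.inl ⟨rfl, quad_cornerOf_left h0 hc h1 p⟩)
  · exact Or.inr (Or.inr (Or.inl ⟨rfl, quad_cornerOf_up hc h1 p⟩))
  · exact Or.inr (Or.inr (Or.inr ⟨rfl, quad_cornerOf_down h0 hc h1 p⟩))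

/-- **Both remainders of a corner are non-zero.** [folklore] -/
theorem rem_ne_zero_cornerOf {k c : ℕ} {u : GridPoint} (hu : IsUnitVec u) (h0 : 0 < c) (hc : c < k)
    (h1 : 1 < k) (p : GridPoint) :
    (cornerOf k p u c).1 % (k : ℤ) ≠ 0 ∧ (cornerOf k p u c).2 % (k : ℤ) ≠ 0 := by
  have key : ∀ {z : GridPoint} {a r b s : ℤ}, quad k z = (a, r, b, s) → r ≠ 0 → s ≠ 0 →
      z.1 % (k : ℤ) ≠ 0 ∧ z.2 % (k : ℤ) ≠ 0 := by
    intro z a r b s h hr hs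
    simp only [quad, Prod.mk.injEq] at h
    exact ⟨h.2.1 ▸ hr, h.2.2.2 ▸ hs⟩
  rcases quad_cornerOf hu h0 hc h1 p with ⟨-, h⟩ | ⟨-, h⟩ | ⟨-, h⟩ | ⟨-, h⟩ <;>
    exact key h (by omega) (by omega)

/-- **A corner lies on no scaled path** (it has no vanishing remainder). [cite: LiskiewiczOgiharaToda2003, §4 (proof of Theorem 7: the squares are attached in the space freed by the enlargement)] -/
theorem cornerOf_not_mem_scalePath {k c : ℕ} {u : GridPoint} (hu : IsUnitVec u) (h0 : 0 < c)
    (hc : c < k) (h1 : 1 < k) (p : GridPoint) {q : GridPoint} {l : List GridPoint}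
    (hch : List.IsChain IsGridEdge (q :: l)) : cornerOf k p u c ∉ scalePath k (q :: l) := fun h => by
  obtain ⟨h1', h2'⟩ := rem_ne_zero_cornerOf hu h0 hc h1 p
  rcases rem_zero_of_mem_scalePath hch h with h | h
  · exact h1' h
  · exact h2' h

/-- **A corner is not a scaled lattice point.** [folklore] -/
theorem cornerOf_ne_smul {k c : ℕ} {u : GridPoint} (hu : IsUnitVec u) (h0 : 0 < c) (hc : c < k)
    (h1 : 1 < k) (p v : GridPoint) : cornerOf k p u c ≠ (k : ℤ) • v := fun h =>
  (rem_ne_zero_cornerOf hu h0 hc h1 p).1 (by rw [h]; exact (rem_zero_smul k v).1)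

/-- The attachment side read off a corner (`2 ≤ c ≤ k - 2`): vertical runs are those whose
corners have first remainder `1`. [folklore] -/
theorem sideVec_eq_of_cornerOf {k c : ℕ} {u : GridPoint} (hu : IsUnitVec u) (h2 : 2 ≤ c)
    (hc : c + 2 ≤ k) (p : GridPoint) :
    sideVec u = if (cornerOf k p u c).1 % (k : ℤ) = 1 then (1, 0) else (0, 1) := by
  have key : ∀ {z : GridPoint} {a r b s : ℤ}, quad k z = (a, r, b, s) → z.1 % (k : ℤ) = r := by
    intro z a r b s h
    simp only [quad, Prod.mk.injEq] at h
    exact h.2.1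
  rcases quad_cornerOf (k := k) (c := c) hu (by omega) (by omega) (by omega) p with
    ⟨hq, h⟩ | ⟨hq, h⟩ | ⟨hq, h⟩ | ⟨hq, h⟩ <;> rw [key h] <;> subst hq
  · rw [if_neg (by omega)]; simp [sideVec]
  · rw [if_neg (by omega)]; simp [sideVec]
  · rw [if_pos rfl]; simp [sideVec]
  · rw [if_pos rfl]; simp [sideVec]

/-- **Equal corners have equal feet** (parameters in `[2, k - 2]`). [folklore] -/
theorem runPt_eq_of_cornerOf_eq {k c c' : ℕ} {u u' : GridPoint} (hu : IsUnitVec u)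
    (hu' : IsUnitVec u') (h2 : 2 ≤ c) (hc : c + 2 ≤ k) (h2' : 2 ≤ c') (hc' : c' + 2 ≤ k)
    {p p' : GridPoint} (h : cornerOf k p u c = cornerOf k p' u' c') :
    runPt k p u c = runPt k p' u' c' := by
  have hn : sideVec u = sideVec u' := by
    rw [sideVec_eq_of_cornerOf hu h2 hc p, sideVec_eq_of_cornerOf hu' h2' hc' p', h]
  unfold cornerOf at h
  rw [hn] at h
  exact add_right_cancel h

/-! ### The squares of a drawn edge -/

/-- The first unit step of a path (junk value on lists with fewer than two points).
[folklore] -/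
def firstStep : List GridPoint → GridPoint × GridPoint
  | p :: q :: _ => (p, q)
  | _ => (gridOrigin, gridOrigin)

/-- **The `j`-th square of the drawn edge `e`** on the drawing scaled by `k`: feet the run
points `2j + 2`, `2j + 3` of the scaled first unit step of `e` ("`β` unit-size squares with a
gap of unit length in between"), corners beside them.
[cite: LiskiewiczOgiharaToda2003, §4 (proof of Theorem 7, E₃, Fig. 8)] -/
def sqSite (k : ℕ) (e : DrawnEdge) (j : ℕ) : SquareSite :=
  ⟨runPt k (firstStep e.2.2).1 ((firstStep e.2.2).2 - (firstStep e.2.2).1) (2 * j + 2),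
   runPt k (firstStep e.2.2).1 ((firstStep e.2.2).2 - (firstStep e.2.2).1) (2 * j + 3),
   cornerOf k (firstStep e.2.2).1 ((firstStep e.2.2).2 - (firstStep e.2.2).1) (2 * j + 2),
   cornerOf k (firstStep e.2.2).1 ((firstStep e.2.2).2 - (firstStep e.2.2).1) (2 * j + 3)⟩

/-- **All the squares**: `β` of them on every drawn edge. [cite: LiskiewiczOgiharaToda2003, §4 (proof of Theorem 7: "for each edge e of G′ … attach … β unit-size squares")] -/
def sqSites (k β : ℕ) (D : List DrawnEdge) : List SquareSite :=
  D.flatMap fun e => (List.range β).map (sqSite k e)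

section Placement

variable {P : List GridPoint} {D : List DrawnEdge} {k β : ℕ}

/-- The path of a drawn edge starts with its first unit step. [folklore] -/
theorem exists_eq_firstStep_cons (hD : IsGridDrawing P D) {e : DrawnEdge} (he : e ∈ D) :
    ∃ l, e.2.2 = (firstStep e.2.2).1 :: (firstStep e.2.2).2 :: l := by
  have hlen := two_le_length_of_isDrawnEdgeOf hD.1 (hD.2.1 e he)
  match h : e.2.2, hlen with
  | p :: q :: l, _ => exact ⟨l, rfl⟩

/-- The first unit step of a drawn edge is a unit vector. [folklore] -/
theorem isUnitVec_firstStep (hD : IsGridDrawing P D) {e : DrawnEdge} (he : e ∈ D) :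
    IsUnitVec ((firstStep e.2.2).2 - (firstStep e.2.2).1) := by
  obtain ⟨l, hl⟩ := exists_eq_firstStep_cons hD he
  have hch := (hD.2.1 e he).2.2.2.2.2.2.1
  rw [hl] at hch
  exact (isGridEdge_iff_isUnitVec _ _).mp (List.isChain_cons_cons.mp hch).1

/-- **The feet are consecutive points of the scaled path of their edge**, at positions `c` and
`c + 1` (`c + 1 < k`). [folklore] -/
theorem getElem_scalePath_firstStep (hD : IsGridDrawing P D) {e : DrawnEdge} (he : e ∈ D)
    {c : ℕ} (hc : c < k) :
    ∃ h : c < (scalePath k e.2.2).length,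
      (scalePath k e.2.2)[c] = runPt k (firstStep e.2.2).1 ((firstStep e.2.2).2 - (firstStep e.2.2).1) c := by
  obtain ⟨l, hl⟩ := exists_eq_firstStep_cons hD he
  rw [hl]
  have hlen : c < (scalePath k ((firstStep e.2.2).1 :: (firstStep e.2.2).2 :: l)).length := by
    rw [length_scalePath, List.length_cons]
    nlinarith
  exact ⟨hlen, getElem_scalePath_lt _ _ l hc hlen⟩

/-- The feet lie on the scaled path of their edge. [folklore] -/
theorem runPt_firstStep_mem_scalePath (hD : IsGridDrawing P D) {e : DrawnEdge} (he : e ∈ D)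
    {c : ℕ} (hc : c < k) :
    runPt k (firstStep e.2.2).1 ((firstStep e.2.2).2 - (firstStep e.2.2).1) c ∈ scalePath k e.2.2 := by
  obtain ⟨h, heq⟩ := getElem_scalePath_firstStep hD he hc
  rw [← heq]
  exact List.getElem_mem h

/-- **A foot with parameter in `(0, k)` is not a scaled lattice point.** [folklore] -/
theorem runPt_firstStep_ne_smul (hD : IsGridDrawing P D) {e : DrawnEdge} (he : e ∈ D) {c : ℕ}
    (h0 : 0 < c) (hc : c < k) (v : GridPoint) :
    runPt k (firstStep e.2.2).1 ((firstStep e.2.2).2 - (firstStep e.2.2).1) c ≠ (k : ℤ) • v :=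
  fun h => by
    have := (smul_eq_runPt (isUnitVec_firstStep hD he) hc h.symm).1
    omega

/-- **Feet of distinct edges differ** (a common foot would be a point of two scaled drawn
paths that is not a scaled vertex image). [cite: LiskiewiczOgiharaToda2003, §4 (proof of Theorem 7: no vertex congestion)] -/
theorem runPt_firstStep_ne (hD : IsGridDrawing P D) (hk : 0 < k) {e e' : DrawnEdge} (he : e ∈ D)
    (he' : e' ∈ D) (hne : e ≠ e') {c c' : ℕ} (h0 : 0 < c) (hc : c < k) (hc' : c' < k) :
    runPt k (firstStep e.2.2).1 ((firstStep e.2.2).2 - (firstStep e.2.2).1) c ≠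
      runPt k (firstStep e'.2.2).1 ((firstStep e'.2.2).2 - (firstStep e'.2.2).1) c' := by
  intro h
  have hmem := hD.smul_of_mem_scalePath hk he he' hne (runPt_firstStep_mem_scalePath hD he hc)
    (h ▸ runPt_firstStep_mem_scalePath hD he' hc')
  obtain ⟨v, -, hv⟩ := List.mem_map.mp hmem
  exact runPt_firstStep_ne_smul hD he h0 hc v hv.symm

/-- Corners of the squares, unfolded. [folklore] -/
theorem isCorner_sqSites_iff {z : GridPoint} :
    IsCorner (sqSites k β D) z ↔ ∃ e ∈ D, ∃ j < β,
      z = cornerOf k (firstStep e.2.2).1 ((firstStep e.2.2).2 - (firstStep e.2.2).1) (2 * j + 2) ∨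
      z = cornerOf k (firstStep e.2.2).1 ((firstStep e.2.2).2 - (firstStep e.2.2).1) (2 * j + 3) := by
  simp only [IsCorner, sqSites, List.mem_flatMap, List.mem_map, List.mem_range]
  constructor
  · rintro ⟨s, ⟨e, he, j, hj, rfl⟩, h⟩
    exact ⟨e, he, j, hj, h⟩
  · rintro ⟨e, he, j, hj, h⟩
    exact ⟨sqSite k e j, ⟨e, he, j, hj, rfl⟩, h⟩

/-- **A scaled lattice point (in particular a scaled vertex image) is not a corner.**
[folklore] -/
theorem not_isCorner_smul (hD : IsGridDrawing P D) (hk : 2 * β + 3 ≤ k) (v : GridPoint) :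
    ¬ IsCorner (sqSites k β D) ((k : ℤ) • v) := by
  rw [isCorner_sqSites_iff]
  rintro ⟨e, he, j, hj, h | h⟩
  · exact cornerOf_ne_smul (isUnitVec_firstStep hD he) (by omega) (by omega) (by omega) _ v h.symm
  · exact cornerOf_ne_smul (isUnitVec_firstStep hD he) (by omega) (by omega) (by omega) _ v h.symm

/-- **The squares are an admissible family of sites on the scaled drawing** (`2β + 3 ≤ k`):
feet are consecutive interior points of the scaled first steps, corners lie off every scaled
path and off the scaled vertex images, corners and feet of distinct squares are distinct.
[cite: LiskiewiczOgiharaToda2003, §4 (proof of Theorem 7, E₃: "β unit-size squares with a gap of unit length in between")] -/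
theorem isSiteList_sqSites (hD : IsGridDrawing P D) (hk : 2 * β + 3 ≤ k) :
    IsSiteList (P.map fun p => (k : ℤ) • p) (scaleDrawing k D) (sqSites k β D) := by
  have hk0 : 0 < k := by omega
  have hk1 : 1 < k := by omega
  -- unpacking membership in `sqSites`
  have hmem : ∀ {s : SquareSite}, s ∈ sqSites k β D → ∃ e ∈ D, ∃ j < β, s = sqSite k e j := by
    intro s hs
    obtain ⟨e, he, hs⟩ := List.mem_flatMap.mp hs
    obtain ⟨j, hj, rfl⟩ := List.mem_map.mp hs
    exact ⟨e, he, j, List.mem_range.mp hj, rfl⟩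
  -- feet and corners of distinct edges never coincide
  have hfeet : ∀ {e e' : DrawnEdge}, e ∈ D → e' ∈ D → e ≠ e' → ∀ {c c' : ℕ}, 2 ≤ c → c + 2 ≤ k →
      c' < k → (sqSite k e 0).p = (sqSite k e 0).p → runPt k (firstStep e.2.2).1
        ((firstStep e.2.2).2 - (firstStep e.2.2).1) c ≠ runPt k (firstStep e'.2.2).1
        ((firstStep e'.2.2).2 - (firstStep e'.2.2).1) c' :=
    fun he he' hne c c' h2 hc hc' _ => runPt_firstStep_ne hD hk0 he he' hne (by omega) (by omega) hc'
  have hcorners : ∀ {e e' : DrawnEdge}, e ∈ D → e' ∈ D → e ≠ e' → ∀ {c c' : ℕ}, 2 ≤ c → c + 2 ≤ k →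
      2 ≤ c' → c' + 2 ≤ k → cornerOf k (firstStep e.2.2).1 ((firstStep e.2.2).2 - (firstStep e.2.2).1) c ≠
        cornerOf k (firstStep e'.2.2).1 ((firstStep e'.2.2).2 - (firstStep e'.2.2).1) c' :=
    fun he he' hne c c' h2 hc h2' hc' h =>
      runPt_firstStep_ne hD hk0 he he' hne (by omega) (by omega) (by omega)
        (runPt_eq_of_cornerOf_eq (isUnitVec_firstStep hD he) (isUnitVec_firstStep hD he') h2 hc h2' hc' h)
  refine ⟨fun s hs => ?_, fun s hs e' he' => ?_, fun s hs => ?_, fun s hs => ?_, ?_, ?_⟩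
  · -- feet are consecutive interior points of the scaled first step
    obtain ⟨e, he, j, hj, rfl⟩ := hmem hs
    obtain ⟨h₁, hp⟩ := getElem_scalePath_firstStep (k := k) hD he (c := 2 * j + 2) (by omega)
    obtain ⟨h₂, hq⟩ := getElem_scalePath_firstStep (k := k) hD he (c := 2 * j + 3) (by omega)
    obtain ⟨h₃, -⟩ := getElem_scalePath_firstStep (k := k) hD he (c := 2 * j + 4) (by omega)
    exact ⟨_, mem_scaleDrawing he, 2 * j + 2, h₃, by omega, hp, hq⟩
  · -- corners lie on no scaled path
    obtain ⟨e, he, j, hj, rfl⟩ := hmem hs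
    obtain ⟨e₀, he₀, rfl⟩ := exists_of_mem_scaleDrawing he'
    obtain ⟨p₀, q₀, l₀, hl⟩ := exists_eq_cons_cons_of_mem hD he₀
    have hch := (hD.2.1 e₀ he₀).2.2.2.2.2.2.1
    simp only
    rw [hl] at hch ⊢
    exact ⟨cornerOf_not_mem_scalePath (isUnitVec_firstStep hD he) (by omega) (by omega) hk1 _ hch,
      cornerOf_not_mem_scalePath (isUnitVec_firstStep hD he) (by omega) (by omega) hk1 _ hch⟩
  · -- corners are no scaled vertex images
    obtain ⟨e, he, j, hj, rfl⟩ := hmem hs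
    constructor <;>
    · intro h
      obtain ⟨v, -, hv⟩ := List.mem_map.mp h
      exact cornerOf_ne_smul (isUnitVec_firstStep hD he) (by omega) (by omega) hk1 _ v hv.symm
  · -- the two corners of a square differ
    obtain ⟨e, he, j, hj, rfl⟩ := hmem hs
    intro h
    have := runPt_injective k _ (isUnitVec_firstStep hD he) (add_right_cancel h)
    omega
  · -- corners of distinct squares differ
    rw [sqSites, List.pairwise_flatMap]
    constructor
    · intro e he
      rw [List.pairwise_map]
      refine List.nodup_range.imp_of_mem ?_
      intro j j' _ _ hjj
      have hinj : ∀ {c c' : ℕ}, cornerOf k (firstStep e.2.2).1 ((firstStep e.2.2).2 - (firstStep e.2.2).1) c =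
          cornerOf k (firstStep e.2.2).1 ((firstStep e.2.2).2 - (firstStep e.2.2).1) c' → c = c' :=
        fun h => runPt_injective k _ (isUnitVec_firstStep hD he) (add_right_cancel h)
      refine ⟨fun h => ?_, fun h => ?_, fun h => ?_, fun h => ?_⟩ <;> have := hinj h <;> omega
    · refine hD.nodup_edges.imp_of_mem ?_
      intro e e' he he' hne s hs s' hs'
      obtain ⟨j, hj, rfl⟩ := List.mem_map.mp hs
      obtain ⟨j', hj', rfl⟩ := List.mem_map.mp hs'
      rw [List.mem_range] at hj hj'
      exact ⟨hcorners he he' hne (by omega) (by omega) (by omega) (by omega),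
        hcorners he he' hne (by omega) (by omega) (by omega) (by omega),
        hcorners he he' hne (by omega) (by omega) (by omega) (by omega),
        hcorners he he' hne (by omega) (by omega) (by omega) (by omega)⟩
  · -- feet of distinct squares differ ("a gap of unit length in between")
    rw [sqSites, List.pairwise_flatMap]
    constructor
    · intro e he
      rw [List.pairwise_map]
      refine List.nodup_range.imp_of_mem ?_
      intro j j' _ _ hjj
      have hinj := runPt_injective k (firstStep e.2.2).1 (isUnitVec_firstStep hD he)
      refine ⟨fun h => ?_, fun h => ?_, fun h => ?_, fun h => ?_⟩ <;> have := hinj h <;> omega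
    · refine hD.nodup_edges.imp_of_mem ?_
      intro e e' he he' hne s hs s' hs'
      obtain ⟨j, hj, rfl⟩ := List.mem_map.mp hs
      obtain ⟨j', hj', rfl⟩ := List.mem_map.mp hs'
      rw [List.mem_range] at hj hj'
      exact ⟨hfeet he he' hne (by omega) (by omega) (by omega) rfl,
        hfeet he he' hne (by omega) (by omega) (by omega) rfl,
        hfeet he he' hne (by omega) (by omega) (by omega) rfl,
        hfeet he he' hne (by omega) (by omega) (by omega) rfl⟩

/-- **The squares are unit squares of `ℤ²`** (the three new sides of every square are grid
edges), so the decorated scaled drawing is a subgraph of the grid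
(`isGridSubgraph_withSquares`). [cite: LiskiewiczOgiharaToda2003, §4 (proof of Theorem 7: E₃ "a subgraph of a two-dimensional grid")] -/
theorem sqSites_geometry (hD : IsGridDrawing P D) :
    ∀ s ∈ sqSites k β D, IsGridEdge s.p s.p' ∧ IsGridEdge s.p' s.q' ∧ IsGridEdge s.q' s.q := by
  intro s hs
  obtain ⟨e, he, hs⟩ := List.mem_flatMap.mp hs
  obtain ⟨j, -, rfl⟩ := List.mem_map.mp hs
  have hu := isUnitVec_firstStep hD he
  refine ⟨isGridEdge_add_sideVec _ _, ?_, (isGridEdge_add_sideVec _ _).symm⟩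
  exact (isGridEdge_runPt_succ k _ hu (2 * j + 2)).add_right _

/-- The decorated scaled drawing is a subgraph of the two-dimensional grid.
[cite: LiskiewiczOgiharaToda2003, §4 (proof of Theorem 7, E₃)] -/
theorem isGridSubgraph_withSquares_sqSites (hD : IsGridDrawing P D) (hk : 0 < k) (β : ℕ) :
    IsGridSubgraph (withSquares (scaleDrawing k D) (sqSites k β D)) :=
  isGridSubgraph_withSquares (hD.scale hk) (sqSites_geometry hD)

/-! ### The number of squares along a realised abstract path -/

/-- **A square of the edge `e` lies along the realisation (in the scaled drawing) of an
abstract path iff the path uses `e`.** [cite: LiskiewiczOgiharaToda2003, §4 (proof of Theorem 7: "for each edge e of G′, now e is realized by a set of 2^β paths")] -/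
theorem listAdj_realize_sqSite_iff (hD : IsGridDrawing P D) (hk : 2 * β + 3 ≤ k) {e : DrawnEdge}
    (he : e ∈ D) {j : ℕ} (hj : j < β) {a : ℕ} {l : List ℕ}
    (hch : List.IsChain (DAdj (scaleDrawing k D)) (a :: l)) :
    ListAdj (realize (P.map fun p => (k : ℤ) • p) (scaleDrawing k D) (a :: l)) (sqSite k e j).p
        (sqSite k e j).q ↔ UsedBy (a :: l) e := by
  have hk0 : 0 < k := by omega
  have hD' := hD.scale hk0
  have hbot : ListAdj (scalePath k e.2.2) (sqSite k e j).p (sqSite k e j).q := by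
    obtain ⟨h₁, hp⟩ := getElem_scalePath_firstStep (k := k) hD he (c := 2 * j + 2) (by omega)
    obtain ⟨h₂, hq⟩ := getElem_scalePath_firstStep (k := k) hD he (c := 2 * j + 3) (by omega)
    exact Or.inl (mem_pathEdges_iff.mpr ⟨2 * j + 2, h₂, hp, hq⟩)
  constructor
  · intro h
    obtain ⟨uv, huv, e', he', hends, hadj⟩ := exists_of_listAdj_realize hD' hch h
    obtain ⟨e₀, he₀, rfl⟩ := exists_of_mem_scaleDrawing he'
    have hlo : (sqSite k e j).p ∈ scalePath k e₀.2.2 := hadj.mem_left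
    have heq : e = e₀ := by
      by_contra hne
      have hmem := hD.smul_of_mem_scalePath hk0 he he₀ hne
        (runPt_firstStep_mem_scalePath (k := k) hD he (c := 2 * j + 2) (by omega)) hlo
      obtain ⟨v, -, hv⟩ := List.mem_map.mp hmem
      exact runPt_firstStep_ne_smul (k := k) hD he (c := 2 * j + 2) (by omega) (by omega) v hv.symm
    subst heq
    exact ⟨uv, by simpa using huv, hends⟩
  · rintro ⟨⟨u, v⟩, huv, hends⟩
    have huv' : (u, v) ∈ (a :: l).zip l := by simpa using huv
    exact listAdj_realize_of_listAdj_path hD' hch (mem_scaleDrawing he) huv' hends hbot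

/-- The list of squares has no repetition. [folklore] -/
theorem nodup_sqSites (hD : IsGridDrawing P D) (hk : 2 * β + 3 ≤ k) : (sqSites k β D).Nodup := by
  have h := (isSiteList_sqSites hD hk).corners_disjoint
  exact h.imp fun {s t} hst heq => by subst heq; exact hst.1 rfl

/-- Summing `β` over the marked members of a list. [folklore] -/
theorem sum_map_ite_eq_mul_countP {α : Type*} (p : α → Prop) [DecidablePred p] (β : ℕ) :
    ∀ l : List α, (l.map fun x => if p x then β else 0).sum = β * l.countP fun x => decide (p x)
  | [] => by simp
  | x :: l => by
    rw [List.map_cons, List.sum_cons, sum_map_ite_eq_mul_countP p β l, List.countP_cons]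
    by_cases h : p x <;> simp [h, mul_add, add_comm]

/-- The scaled drawing has the same abstract simple paths. [folklore] -/
theorem isAbsPath_scaleDrawing_iff (k : ℕ) {D : List DrawnEdge} {N : ℕ} {l : List ℕ} :
    IsAbsPath N (scaleDrawing k D) l ↔ IsAbsPath N D l := by
  unfold IsAbsPath
  rw [List.IsChain.iff fun u v => dAdj_scaleDrawing k D u v]

/-- The scaled drawing has the same abstract simple `s`–`t` paths. [folklore] -/
theorem absPathsFromTo_scaleDrawing (k N : ℕ) (D : List DrawnEdge) (s t : ℕ) :
    absPathsFromTo N (scaleDrawing k D) s t = absPathsFromTo N D s t := by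
  ext l
  simp only [mem_absPathsFromTo, isAbsPath_scaleDrawing_iff]

/-- **The realisation of an abstract simple path with `m + 1` vertices runs along exactly
`β m` squares.** [cite: LiskiewiczOgiharaToda2003, §4 (proof of Theorem 7, fourth type: a Hamiltonian path carries 2^{β(N+1)} walks)] -/
theorem card_sitesAlong_sqSites_realize (hD : IsGridDrawing P D) (hk : 2 * β + 3 ≤ k) {a : ℕ}
    {l : List ℕ} (hpath : IsAbsPath P.length D (a :: l)) :
    (sitesAlong (sqSites k β D) (realize (P.map fun p => (k : ℤ) • p) (scaleDrawing k D) (a :: l))).card =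
      β * l.length := by
  have hch : List.IsChain (DAdj (scaleDrawing k D)) (a :: l) :=
    ((isAbsPath_scaleDrawing_iff k).mpr hpath).2.2
  rw [sitesAlong, List.toFinset_card_of_nodup ((nodup_sqSites hD hk).filter _),
    ← List.countP_eq_length_filter, sqSites, List.countP_flatMap, ← countP_usedBy hD hpath,
    ← sum_map_ite_eq_mul_countP]
  congr 1
  refine List.map_congr_left fun e he => ?_
  rw [Function.comp_apply, List.countP_map]
  by_cases hu : UsedBy (a :: l) e
  · rw [if_pos hu]
    conv_rhs => rw [← List.length_range (n := β)]
    rw [List.countP_eq_length]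
    intro j hj
    simp only [Function.comp_apply, decide_eq_true_eq]
    exact (listAdj_realize_sqSite_iff hD hk he (List.mem_range.mp hj) hch).mpr hu
  · rw [if_neg hu, List.countP_eq_zero]
    intro j hj
    simp only [Function.comp_apply, decide_eq_true_eq]
    exact fun h => hu ((listAdj_realize_sqSite_iff hD hk he (List.mem_range.mp hj) hch).mp h)

/-- **The counting identity of the squares step.** For a congestion-free grid drawing `(P, D)`
of a simple graph of maximum degree three, distinct vertices `s ≠ t` and `2β + 3 ≤ k`: the
self-avoiding walks of the scaled drawing decorated with the squares, from the image of `s` to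
the image of `t`, number `Σ_π 2 ^ (β · #edges(π))`, the sum over the abstract simple `s`–`t`
paths `π` ("the number of SAWs between the origin and the image of `t′` is [`Y · 2^{β(N+1)}`
plus the contribution of the `η` non-Hamiltonian simple paths]").
[cite: LiskiewiczOgiharaToda2003, Theorem 7 (proof, fourth type)] -/
theorem ncard_saw_squares (hD : IsGridDrawing P D) (hk : 2 * β + 3 ≤ k) {s t : ℕ}
    (hs : s < P.length) (ht : t < P.length) (hst : s ≠ t) :
    {ω : List GridPoint | IsSAWIn (withSquares (scaleDrawing k D) (sqSites k β D)) ω ∧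
        ω.head? = some ((k : ℤ) • P[s]) ∧ ω.getLast? = some ((k : ℤ) • P[t])}.ncard =
      ∑ l ∈ (absPathsFromTo_finite P.length D s t).toFinset, 2 ^ (β * (l.length - 1)) := by
  have hk0 : 0 < k := by omega
  have hD' := hD.scale hk0
  have hs' : s < (P.map fun p => (k : ℤ) • p).length := by simpa using hs
  have ht' : t < (P.map fun p => (k : ℤ) • p).length := by simpa using ht
  have hPs : (P.map fun p => (k : ℤ) • p)[s] = (k : ℤ) • P[s] := List.getElem_map _
  have hPt : (P.map fun p => (k : ℤ) • p)[t] = (k : ℤ) • P[t] := List.getElem_map _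
  rw [(isSiteList_sqSites hD hk).ncard_saw_withSquares hD' (not_isCorner_smul hD hk _)
    (not_isCorner_smul hD hk _), ← hPs, ← hPt, sum_sawFinset_drawnEdges_eq hD' hs' ht' hst]
  refine Finset.sum_congr (Set.Finite.toFinset_inj.mpr ?_) fun l hl => ?_
  · rw [List.length_map, absPathsFromTo_scaleDrawing]
  · obtain ⟨hpath, hhead, -⟩ := (Set.Finite.mem_toFinset _).mp hl
    match l, hhead with
    | a :: l, _ =>
      rw [card_sitesAlong_sqSites_realize hD hk hpath, List.length_cons, Nat.add_sub_cancel]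

end Placement

end Literature.Barriers.CriticalPhenomena.GridSAW
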